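import Literature.NumberTheory.Automorphic.UnitaryThreeBoundaryRigidityLevelTwoUnitFactor   -- (this hand) RIGID-2 ★ p846374 in unit-factor form
import Literature.NumberTheory.Automorphic.ResiduallyTrivialFixedCosetCount            -- ★ A-p12 ROW-0 bridge `rank_redMat_sub_one_eq_zero_iff_forall_valuation_le`, `redMat_eq_zero_iff_forall_valuation_lt_one`
import Literature.NumberTheory.Automorphic.UnitaryGroupIntegralPointsReductionInert    -- ★ `σ̄_w = Frob`, `|𝓀_w| = q²`
import Literature.NumberTheory.Automorphic.LocalUnitaryIntegralLevel                   -- ★ `cmLocalIntegralLevel`, `mem_localIntegralLevel_iff_of_smul_eq`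
import Literature.NumberTheory.Automorphic.Liu2021.LemD1AsPrintedIndexedNonVacuityInertCofinite  -- ★ `valued_toPlace_uniformizer_of_isUnramifiedIn`
import Literature.NumberTheory.Automorphic.ValuedFieldValuativeRelBridge               -- ★ `isUniformizingElement_of_v_eq`, `v_le_iff_valuation_le`
import Literature.NumberTheory.Automorphic.UnitaryGroupInertPlaceHyperbolicBasis       -- ★ `galAdicCompletionMap_galAdicCompletionMap_of_smul_eq`
import Literature.NumberTheory.Automorphic.HyperspecialUnitaryCartanAdicCompletion     -- ★ `unramifiedLocalConjDatum_adicCompletion`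
import Literature.NumberTheory.Automorphic.UnitaryLevelTwoInteriorRelabel              -- ★ p846407 `mem_glInt_iff_isIntMatrix`, `isIntMatrix_inv_smul_iff`
import Literature.NumberTheory.Automorphic.UnramifiedTraceZeroLatticeIndex             -- ★ `exists_v_eq_one_and_map_eq_neg` (a skew unit `t₀`)
import Literature.NumberTheory.Automorphic.LocalUnitaryGroupCongr                      -- ★ `antidiagOne_eq_over`
import Literature.NumberTheory.Automorphic.SatakeW0SymmetryAdicCompletion              -- ★ `exists_galAdicCompletionMap_ne` (`σ_w ≠ id`)
import Literature.NumberTheory.Rogawski1990.UnitFundamentalLemmaInertFlickerFrame      -- ★ «THE FRAME» `exists_frame_of_nonsplit`, `isUnit_two_integer_iff_valued_eq_one`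
import Literature.NumberTheory.Rogawski1990.U3SupercuspidalJacquetVanishing           -- ★ `coe_localNonsplitEquiv_apply` (rfl)
import Literature.GroupTheory.SpecificGroups.FiniteUnitaryThreeUnipotentJordanClasses  -- ★ p845492 §1 rank dictionary, `exists_norm_eq_of_frob`
import HarnessLib

/-!
# Level-2 `K`-class pieces: the two BOUNDARY VALUES (organ V, BD-half — Rogawski §4.9 ∕ §3.9)

Let `L∕L⁺` be CM, `v` a finite place of `L⁺` inert and unramified in `L` (`w ∣ v`, `σ_w`), `2 ∈ 𝒪_w^×`, `H′` hermitian with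
`H′_w` unimodular, `G′_v = U(H′)(L⁺_v)`, `K = U(H′)(𝒪_v)` hyperspecial.  A *level-2 `K`-class piece* is a function `g` on `G′_v`
that is `Ad K`-invariant and LEFT-invariant under the congruence subgroup `K(2) = {u : u_w ≡ 1 (ϖ_v²)}`.

**Main results.**
* `exists_v_mul_map_sub_lt_one_of_inert` — at an inert unramified `w` every `σ_w`-fixed unit is a norm modulo `𝔪_w`
  (the residual norm `𝔽_{q²}^× → 𝔽_q^×` is onto, ★ `exists_norm_eq_of_frob`): the hypothesis `hN` of RIGID-2.
* `apply_eq_of_two_deep_of_rank_redMat_sub_one` — THE HEART: in a good-reduction frame `e : G′_v ≃ U(σ_w, Φ₃)(L_w)`,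
  `(e z) = T (z_w) T⁻¹`, `T ∈ GL₃(𝒪_w)` (★ `exists_frame_of_nonsplit`), a residually unipotent `x ∈ K` that is
  `G′_v`-conjugate into `K(2)` satisfies `g x = g (e⁻¹ n(t₀))` if `rank(red x_w − 1) = 1` and `g x = g (e⁻¹ u(1,b₀))` if
  the rank is `2` — RIGID-2 (★ `levelTwo_conj_cornerUnipotent_of_two_deep`, ★ `levelTwo_conj_upperUnipotent_one_of_two_deep`,
  Rogawski Prop. 3.9.1 one level up) read through the frame, then `Ad K`- and `K(2)`-invariance.
* `exists_boundaryValues_of_levelTwo` — ORGAN V, BD-half, in the END's tokens: `∃ c : ℕ → ℂ`, `c 0 = 0`, and `g x = c s`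
  on the stratum «`x ∈ K`, `(red x_w − 1)³ = 0`, `rank (red x_w − 1) = s`, `x` conjugate into `K(2)`» for `s = 1, 2`.

The print: [Rogawski1990] §3.9 p. 32 (classes `n(t)`, `u(a,b)`, Prop. 3.9.1), §4.9 p. 54; [Tits1979] §3.5 (congruence filtration of
hyperspecial `K`); [Kottwitz1986] §3.  Formal content = the tree's RIGID-2 normal forms read through the good-reduction frame.

## References
* [Rogawski1990] J. Rogawski, *Automorphic Representations of Unitary Groups in Three Variables*, Ann. of Math. Stud. 123
  (1990), §3.9 p. 32, Prop. 3.9.1; §4.9 p. 54.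
* [Tits1979] J. Tits, *Reductive groups over local fields*, PSPM 33.1 (1979), §3.5.
* [Kottwitz1986] R. Kottwitz, *Base change for unit elements of Hecke algebras*, Compositio Math. 60 (1986), §3.
-/

set_option autoImplicit false

noncomputable section

open NumberField IsDedekindDomain Matrix ValuativeRel
open Literature.NumberTheory.Automorphic Literature.NumberTheory.GaloisRepresentations Literature.NumberTheory.Automorphic.UnitaryGroup
open Literature.NumberTheory.Automorphic.IntegralReduction Literature.GroupTheory.SpecificGroups
open Literature.NumberTheory.Automorphic.HermitianLattice Literature.NumberTheory.Automorphic.UnitaryLatticeTree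
open scoped Matrix MatrixGroups ValuativeRel

namespace Literature.NumberTheory.Rogawski1990

section OrganVBoundary

set_option maxHeartbeats 400000 in
-- budget only: residue-field bookkeeping at the CM place.
/-- **At an inert unramified place every `σ_w`-fixed unit is a norm modulo `𝔪_w`**: for `u ∈ 𝒪_w^×` with `σ_w u = u` there is
`z` with `v_w(z·σ_w z − u) < 1` — the residual norm `N : 𝔽_{q²}^× → 𝔽_q^×` is onto (★ `exists_norm_eq_of_frob` with `σ̄_w = Frob_q`,
★ `residueHom_galAdicCompletionMap_eq_pow`).  This is the hypothesis `hN` of RIGID-2. [cite: Rogawski1990, §3.9 p. 32] [cite: Serre1979, Ch. V §2] -/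
theorem exists_v_mul_map_sub_lt_one_of_inert
    (L : Type) [Field L] [NumberField L] [IsCMField L]
    {v : HeightOneSpectrum (𝓞 ↥(maximalRealSubfield L))}
    (w : PlacesOver L v) (hw : IsCMField.complexConj L • w.1 = w.1) (hv : Algebra.IsUnramifiedIn (𝓞 L) v.asIdeal)
    (u : (w.1.adicCompletion L)) (hσu : (galAdicCompletionMap (L := L) (IsCMField.complexConj L) hw) u = u) (hu : Valued.v u = 1) :
    ∃ z : (w.1.adicCompletion L), Valued.v (z * (galAdicCompletionMap (L := L) (IsCMField.complexConj L) hw) z - u) < 1 := by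
  classical
  have hc1 : IsCMField.complexConj L ≠ 1 := IsCMField.complexConj_ne_one L
  have hσO : ∀ x : 𝒪[(w.1.adicCompletion L)], (galAdicCompletionMap (L := L) (IsCMField.complexConj L) hw) x ∈ 𝒪[(w.1.adicCompletion L)] := mem_integer_galAdicCompletionMap (IsCMField.complexConj L) v w hw
  obtain ⟨σk, hσk⟩ := exists_residueField_ringHom_galAdicCompletionMap (IsCMField.complexConj L) v w hw
  have hq : Nat.card 𝓀[(w.1.adicCompletion L)] = Nat.card (𝓞 ↥(maximalRealSubfield L) ⧸ v.asIdeal) ^ 2 := natCard_residueField_eq_sq_of_inert (IsCMField.complexConj L) v hc1 hv w hw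
  have hσq : ∀ y : 𝓀[(w.1.adicCompletion L)], σk y = y ^ Nat.card (𝓞 ↥(maximalRealSubfield L) ⧸ v.asIdeal) :=
    residueHom_galAdicCompletionMap_eq_pow (IsCMField.complexConj L) v hc1 hv w hw σk hσO hσk
  letI : Fintype 𝓀[(w.1.adicCompletion L)] := Fintype.ofFinite _
  have hq' : Fintype.card 𝓀[(w.1.adicCompletion L)] = Nat.card (𝓞 ↥(maximalRealSubfield L) ⧸ v.asIdeal) ^ 2 := by rw [← Nat.card_eq_fintype_card, hq]
  -- `u` as an integer; its residue is a non-zero `σ̄`-fixed element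
  have hu1 : u ∈ 𝒪[(w.1.adicCompletion L)] := (v_le_one_iff_mem_integer u).1 hu.le
  obtain ⟨uO, huO⟩ : ∃ uO : 𝒪[(w.1.adicCompletion L)], (uO : (w.1.adicCompletion L)) = u := ⟨⟨u, hu1⟩, rfl⟩
  have hred_ne : IsLocalRing.residue 𝒪[(w.1.adicCompletion L)] uO ≠ 0 := by
    rw [← red_coe, huO]
    exact red_ne_zero_of_valuation_eq_one ((v_eq_one_iff_valuation_eq_one u).1 hu)
  have hσuO : (⟨(galAdicCompletionMap (L := L) (IsCMField.complexConj L) hw) uO, hσO uO⟩ : 𝒪[(w.1.adicCompletion L)]) = uO := Subtype.ext (by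
    show (galAdicCompletionMap (L := L) (IsCMField.complexConj L) hw) (uO : (w.1.adicCompletion L)) = (uO : (w.1.adicCompletion L))
    rw [huO]; exact hσu)
  have hfix : σk (IsLocalRing.residue 𝒪[(w.1.adicCompletion L)] uO) = IsLocalRing.residue 𝒪[(w.1.adicCompletion L)] uO := by
    rw [← hσk uO, hσuO]
  obtain ⟨zb, hzb⟩ := exists_norm_eq_of_frob hq' σk hσq hfix hred_ne
  obtain ⟨zO, hzO⟩ : ∃ zO : 𝒪[(w.1.adicCompletion L)], IsLocalRing.residue 𝒪[(w.1.adicCompletion L)] zO = zb := Ideal.Quotient.mk_surjective zb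
  refine ⟨(zO : (w.1.adicCompletion L)), ?_⟩
  have hint : (zO : (w.1.adicCompletion L)) * (galAdicCompletionMap (L := L) (IsCMField.complexConj L) hw) zO - u ∈ 𝒪[(w.1.adicCompletion L)] := sub_mem (mul_mem zO.2 (hσO zO)) hu1
  have hres : IsLocalRing.residue 𝒪[(w.1.adicCompletion L)] ⟨(zO : (w.1.adicCompletion L)) * (galAdicCompletionMap (L := L) (IsCMField.complexConj L) hw) zO - u, hint⟩ = 0 := by
    have hel : (⟨(zO : (w.1.adicCompletion L)) * (galAdicCompletionMap (L := L) (IsCMField.complexConj L) hw) zO - u, hint⟩ : 𝒪[(w.1.adicCompletion L)]) = zO * ⟨(galAdicCompletionMap (L := L) (IsCMField.complexConj L) hw) zO, hσO zO⟩ - uO :=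
      Subtype.ext (by
        show (zO : (w.1.adicCompletion L)) * (galAdicCompletionMap (L := L) (IsCMField.complexConj L) hw) zO - u = (((zO * ⟨(galAdicCompletionMap (L := L) (IsCMField.complexConj L) hw) zO, hσO zO⟩ - uO : 𝒪[(w.1.adicCompletion L)])) : (w.1.adicCompletion L))
        rw [← huO]; rfl)
    rw [hel, map_sub, map_mul, hσk zO, hzO, mul_comm, hzb, sub_self]
  have hne : valuation (w.1.adicCompletion L) ((zO : (w.1.adicCompletion L)) * (galAdicCompletionMap (L := L) (IsCMField.complexConj L) hw) zO - u) ≠ 1 := by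
    intro h1
    apply red_ne_zero_of_valuation_eq_one h1
    have hc : ((zO : (w.1.adicCompletion L)) * (galAdicCompletionMap (L := L) (IsCMField.complexConj L) hw) zO - u) = ((⟨(zO : (w.1.adicCompletion L)) * (galAdicCompletionMap (L := L) (IsCMField.complexConj L) hw) zO - u, hint⟩ : 𝒪[(w.1.adicCompletion L)]) : (w.1.adicCompletion L)) := rfl
    rw [hc, red_coe]
    exact hres
  have hle : Valued.v ((zO : (w.1.adicCompletion L)) * (galAdicCompletionMap (L := L) (IsCMField.complexConj L) hw) zO - u) ≤ 1 := (v_le_one_iff_mem_integer _).2 hint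
  exact lt_of_le_of_ne hle (fun h => hne ((v_eq_one_iff_valuation_eq_one _).1 h))

set_option maxHeartbeats 800000 in
-- budget only: one statement-heavy declaration (the CM-place tokens); no search tactic runs long here.
/-- **Pull-back of a level-2 unit factorisation along a good-reduction frame.**  In a frame `e : G′_v ≃ U(σ_w, Φ₃)(L_w)` with
`(e z) = T z_w T⁻¹`, `T ∈ GL₃(𝒪_w)`, `K ↔ GL₃(𝒪_w)` (★ `exists_frame_of_nonsplit`): if `k (e x) k⁻¹ = u · (e z_T)` with `k ∈ U(σ_w,J₀) ∩ GL₃(𝒪_w)`,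
`u ∈ U(σ_w,J₀)`, `u ≡ 1 (ϖ_v²)`, then `g x = g z_T` for every `Ad K`-invariant, `K(2)`-left-invariant `g` — `k′ := e⁻¹ k ∈ K`, `u′ := e⁻¹ u ∈ K(2)`
(congruences transported by ★ `isIntMatrix_smul_conj_sub_one`), `g x = g(k′xk′⁻¹) = g(u′ z_T) = g z_T`. [cite: Rogawski1990, §4.9 p. 54] [cite: Tits1979, §3.5] -/
theorem apply_eq_of_conj_eq_levelTwo_mul
    (L : Type) [Field L] [NumberField L] [IsCMField L] (H' : Matrix (Fin 3) (Fin 3) L)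
    {v : HeightOneSpectrum (𝓞 ↥(maximalRealSubfield L))}
    (w : PlacesOver L v) (hw : IsCMField.complexConj L • w.1 = w.1)
    (g : ((cmDatum L 3 H').Local v) → ℂ)
    (hginv : ∀ u ∈ (cmLocalIntegralLevel L 3 H' v), ∀ x, g (u * x * u⁻¹) = g x)
    (hg2 : ∀ u : ((cmDatum L 3 H').Local v),
      (∀ a b, Valued.v (((toPlace v w (HeckeCharacter.uniformizer ↥(maximalRealSubfield L) v : v.adicCompletion ↥(maximalRealSubfield L))) ^ 2)⁻¹ * (((((localNonsplitEquiv (IsCMField.complexConj L) H' (IsCMField.complexConj_ne_one L) w hw u) : ↥(unitaryGroupOfForm (galAdicCompletionMap (L := L) (IsCMField.complexConj L) hw) (placeForm H' w.1))) : GL (Fin 3) (w.1.adicCompletion L)) : Matrix (Fin 3) (Fin 3) (w.1.adicCompletion L)) a b - (1 : Matrix (Fin 3) (Fin 3) (w.1.adicCompletion L)) a b)) ≤ 1) →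
      ∀ x, g (u * x) = g x)
    (T : GL (Fin 3) (w.1.adicCompletion L)) (hT : T ∈ glInt 3 (w.1.adicCompletion L))
    (e : ↥(UnitaryGroup.«local» L (IsCMField.complexConj L) 3 H' v) ≃ₜ* ↥(unitaryGroupOfForm (galAdicCompletionMap (L := L) (IsCMField.complexConj L) hw) (placeForm (Matrix.of fun i j : Fin 3 => if i.val + j.val + 1 = 3 then (1 : L) else 0) w.1)))
    (he : ∀ z, ((e z).val : GL (Fin 3) (w.1.adicCompletion L)) = T * (((localNonsplitEquiv (IsCMField.complexConj L) H' (IsCMField.complexConj_ne_one L) w hw z)).val : GL (Fin 3) (w.1.adicCompletion L)) * T⁻¹)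
    (hKe : ∀ z, z ∈ cmLocalIntegralLevel L 3 H' v ↔ ((e z).val : GL (Fin 3) (w.1.adicCompletion L)) ∈ glInt 3 (w.1.adicCompletion L))
    {x zT : ((cmDatum L 3 H').Local v)} {k u : GL (Fin 3) (w.1.adicCompletion L)} (hkU : k ∈ (unitaryGroupOfForm (galAdicCompletionMap (L := L) (IsCMField.complexConj L) hw) ((StdForm.antidiagonal 3).over (w.1.adicCompletion L)))) (hki : IsIntMatrix (k : Matrix (Fin 3) (Fin 3) (w.1.adicCompletion L))) (hki' : IsIntMatrix ((k⁻¹ : GL (Fin 3) (w.1.adicCompletion L)) : Matrix (Fin 3) (Fin 3) (w.1.adicCompletion L)))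
    (huU : u ∈ (unitaryGroupOfForm (galAdicCompletionMap (L := L) (IsCMField.complexConj L) hw) ((StdForm.antidiagonal 3).over (w.1.adicCompletion L)))) (hu2 : IsIntMatrix (((toPlace v w (HeckeCharacter.uniformizer ↥(maximalRealSubfield L) v : v.adicCompletion ↥(maximalRealSubfield L))) ^ 2)⁻¹ • ((u : Matrix (Fin 3) (Fin 3) (w.1.adicCompletion L)) - 1)))
    (hkxk : k * ((e x).val : GL (Fin 3) (w.1.adicCompletion L)) * k⁻¹ = u * ((e zT).val : GL (Fin 3) (w.1.adicCompletion L))) : g x = g zT := by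
  classical
  have hJw : placeForm (Matrix.of fun i j : Fin 3 => if i.val + j.val + 1 = 3 then (1 : L) else 0) w.1 = ((StdForm.antidiagonal 3).over (w.1.adicCompletion L)) := by
    rw [placeForm, antidiagOne_eq_over, StdForm.over_map]
  have hU' : ∀ {X : GL (Fin 3) (w.1.adicCompletion L)}, X ∈ (unitaryGroupOfForm (galAdicCompletionMap (L := L) (IsCMField.complexConj L) hw) ((StdForm.antidiagonal 3).over (w.1.adicCompletion L))) → X ∈ (unitaryGroupOfForm (galAdicCompletionMap (L := L) (IsCMField.complexConj L) hw) (placeForm (Matrix.of fun i j : Fin 3 => if i.val + j.val + 1 = 3 then (1 : L) else 0) w.1)) := fun {X} hX => by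
    rw [hJw]; exact hX
  have hTi : IsIntMatrix (T : Matrix (Fin 3) (Fin 3) (w.1.adicCompletion L)) := ((mem_glInt_iff_isIntMatrix L 3 w T).1 hT).1
  have hTi' : IsIntMatrix ((T⁻¹ : GL (Fin 3) (w.1.adicCompletion L)) : Matrix (Fin 3) (Fin 3) (w.1.adicCompletion L)) := ((mem_glInt_iff_isIntMatrix L 3 w T).1 hT).2
  have hT'T : ((T⁻¹ : GL (Fin 3) (w.1.adicCompletion L)) : Matrix (Fin 3) (Fin 3) (w.1.adicCompletion L)) * (T : Matrix (Fin 3) (Fin 3) (w.1.adicCompletion L)) = 1 := by rw [← Units.val_mul, inv_mul_cancel, Units.val_one]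
  obtain ⟨k', hk'⟩ : ∃ k' : ((cmDatum L 3 H').Local v), k' = e.symm ⟨k, hU' hkU⟩ := ⟨_, rfl⟩
  obtain ⟨u', hu'⟩ : ∃ u' : ((cmDatum L 3 H').Local v), u' = e.symm ⟨u, hU' huU⟩ := ⟨_, rfl⟩
  have hek' : e k' = ⟨k, hU' hkU⟩ := by rw [hk']; exact e.apply_symm_apply _
  have heu' : e u' = ⟨u, hU' huU⟩ := by rw [hu']; exact e.apply_symm_apply _
  have hek'v : ((e k').val : GL (Fin 3) (w.1.adicCompletion L)) = k := by rw [hek']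
  have heu'v : ((e u').val : GL (Fin 3) (w.1.adicCompletion L)) = u := by rw [heu']
  have hk'K : k' ∈ (cmLocalIntegralLevel L 3 H' v) :=
    (hKe k').2 (by rw [hek'v]; exact (mem_glInt_iff_isIntMatrix L 3 w k).2 ⟨hki, hki'⟩)
  -- `k′ x k′⁻¹ = u′ z_T`, read in `U(σ_w, J₀)`
  have hm1 : e (k' * x * k'⁻¹) = e (k' * x) * e k'⁻¹ := map_mul e _ _
  have hm2 : e (k' * x) = e k' * e x := map_mul e _ _
  have hm3 : e k'⁻¹ = (e k')⁻¹ := map_inv e _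
  have hm4 : e (u' * zT) = e u' * e zT := map_mul e _ _
  have hprod : k' * x * k'⁻¹ = u' * zT := by
    apply e.injective
    rw [hm1, hm2, hm3, hm4]
    apply Subtype.ext
    show ((e k').val : GL (Fin 3) (w.1.adicCompletion L)) * (e x).val * ((e k').val)⁻¹ = (e u').val * (e zT).val
    rw [hek'v, heu'v]
    exact hkxk
  -- `u′ ∈ K(2)`: the `hg2` token
  have hU₀ : (((localNonsplitEquiv (IsCMField.complexConj L) H' (IsCMField.complexConj_ne_one L) w hw u')).val : GL (Fin 3) (w.1.adicCompletion L)) = T⁻¹ * u * T := by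
    have h := he u'
    rw [heu'v] at h
    rw [h]; group
  have hu'2 : IsIntMatrix (((toPlace v w (HeckeCharacter.uniformizer ↥(maximalRealSubfield L) v : v.adicCompletion ↥(maximalRealSubfield L))) ^ 2)⁻¹ • ((((((localNonsplitEquiv (IsCMField.complexConj L) H' (IsCMField.complexConj_ne_one L) w hw u')).val : GL (Fin 3) (w.1.adicCompletion L)) : Matrix (Fin 3) (Fin 3) (w.1.adicCompletion L))) - 1)) := by
    have h := isIntMatrix_smul_conj_sub_one (((toPlace v w (HeckeCharacter.uniformizer ↥(maximalRealSubfield L) v : v.adicCompletion ↥(maximalRealSubfield L))) ^ 2)⁻¹) hTi' hTi hT'T hu2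
    have hm : ((((localNonsplitEquiv (IsCMField.complexConj L) H' (IsCMField.complexConj_ne_one L) w hw u')).val : GL (Fin 3) (w.1.adicCompletion L)) : Matrix (Fin 3) (Fin 3) (w.1.adicCompletion L)) = ((T⁻¹ : GL (Fin 3) (w.1.adicCompletion L)) : Matrix (Fin 3) (Fin 3) (w.1.adicCompletion L)) * (u : Matrix (Fin 3) (Fin 3) (w.1.adicCompletion L)) * (T : Matrix (Fin 3) (Fin 3) (w.1.adicCompletion L)) := by
      rw [hU₀]; simp only [Units.val_mul]
    rw [hm]; exact h
  have hu'tok : (∀ a b, Valued.v (((toPlace v w (HeckeCharacter.uniformizer ↥(maximalRealSubfield L) v : v.adicCompletion ↥(maximalRealSubfield L))) ^ 2)⁻¹ * (((((localNonsplitEquiv (IsCMField.complexConj L) H' (IsCMField.complexConj_ne_one L) w hw u') : ↥(unitaryGroupOfForm (galAdicCompletionMap (L := L) (IsCMField.complexConj L) hw) (placeForm H' w.1))) : GL (Fin 3) (w.1.adicCompletion L)) : Matrix (Fin 3) (Fin 3) (w.1.adicCompletion L)) a b - (1 : Matrix (Fin 3) (Fin 3) (w.1.adicCompletion L)) a b))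 ≤ 1) := fun a b => by
    have h := hu'2 a b
    simp only [Matrix.smul_apply, Matrix.sub_apply, smul_eq_mul] at h
    exact h
  calc g x = g (k' * x * k'⁻¹) := (hginv k' hk'K x).symm
    _ = g (u' * zT) := by rw [hprod]
    _ = g zT := hg2 u' hu'tok zT

set_option maxHeartbeats 800000 in
-- budget only: one statement-heavy declaration (the CM-place tokens); no search tactic runs long here.
/-- **THE HEART — the value of a level-2 `K`-class piece at a residually unipotent `x ∈ K` of Jordan rank `1` (resp. `2`) that is
`G′_v`-conjugate into `K(2)` is `g (e⁻¹ n(t₀))` (resp. `g (e⁻¹ u(1,b₀))`).**  In a good-reduction frame `e` (`(e z) = T z_w T⁻¹`,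
`T ∈ GL₃(𝒪_w)`, `K ↔ GL₃(𝒪_w)`): the 2-deep conjugate `γ = y x y⁻¹` makes RIGID-2 applicable to `e x = (e y)⁻¹ (e γ) (e y)`
(★ `exists_conj_eq_levelTwo_mul_cornerUnipotent_of_two_deep` ∕ `…upperUnipotent_one…`: `k (e x) k⁻¹ = u · n` with `k ∈ U(𝒪_w)`,
`u ≡ 1 (ϖ²)`); pulled back along `e`, `k′ x k′⁻¹ = u′ · n_T` with `k′ ∈ K`, `u′ ∈ K(2)`, so `g x = g(k′xk′⁻¹) = g(u′ n_T) = g n_T`.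
The Jordan rank of `red(x_w) − 1` is read as RIGID-2's congruences by ★ `rank_redMat_sub_one_eq_zero_iff_forall_valuation_le`
and ★ `redMat_eq_zero_iff_forall_valuation_lt_one`. [cite: Rogawski1990, §3.9 p. 32, Prop. 3.9.1; §4.9 p. 54] [cite: Tits1979, §3.5] [cite: Kottwitz1986, §3] -/
theorem apply_eq_of_two_deep_of_rank_redMat_sub_one
    (L : Type) [Field L] [NumberField L] [IsCMField L] (H' : Matrix (Fin 3) (Fin 3) L)
    {v : HeightOneSpectrum (𝓞 ↥(maximalRealSubfield L))}
    (w : PlacesOver L v) (hw : IsCMField.complexConj L • w.1 = w.1) (hv : Algebra.IsUnramifiedIn (𝓞 L) v.asIdeal)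
    (h2 : IsUnit (2 : 𝒪[(w.1.adicCompletion L)]))
    (g : ((cmDatum L 3 H').Local v) → ℂ)
    (hginv : ∀ u ∈ (cmLocalIntegralLevel L 3 H' v), ∀ x, g (u * x * u⁻¹) = g x)
    (hg2 : ∀ u : ((cmDatum L 3 H').Local v),
      (∀ a b, Valued.v (((toPlace v w (HeckeCharacter.uniformizer ↥(maximalRealSubfield L) v : v.adicCompletion ↥(maximalRealSubfield L))) ^ 2)⁻¹ * (((((localNonsplitEquiv (IsCMField.complexConj L) H' (IsCMField.complexConj_ne_one L) w hw u) : ↥(unitaryGroupOfForm (galAdicCompletionMap (L := L) (IsCMField.complexConj L) hw) (placeForm H' w.1))) : GL (Fin 3) (w.1.adicCompletion L)) : Matrix (Fin 3) (Fin 3) (w.1.adicCompletion L)) a b - (1 : Matrix (Fin 3) (Fin 3) (w.1.adicCompletion L)) a b)) ≤ 1) →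
      ∀ x, g (u * x) = g x)
    (T : GL (Fin 3) (w.1.adicCompletion L)) (hT : T ∈ glInt 3 (w.1.adicCompletion L))
    (e : ↥(UnitaryGroup.«local» L (IsCMField.complexConj L) 3 H' v) ≃ₜ* ↥(unitaryGroupOfForm (galAdicCompletionMap (L := L) (IsCMField.complexConj L) hw) (placeForm (Matrix.of fun i j : Fin 3 => if i.val + j.val + 1 = 3 then (1 : L) else 0) w.1)))
    (he : ∀ z, ((e z).val : GL (Fin 3) (w.1.adicCompletion L)) = T * (((localNonsplitEquiv (IsCMField.complexConj L) H' (IsCMField.complexConj_ne_one L) w hw z)).val : GL (Fin 3) (w.1.adicCompletion L)) * T⁻¹)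
    (hKe : ∀ z, z ∈ cmLocalIntegralLevel L 3 H' v ↔ ((e z).val : GL (Fin 3) (w.1.adicCompletion L)) ∈ glInt 3 (w.1.adicCompletion L))
    {t₀ b₀ : (w.1.adicCompletion L)} (ht₀ : (galAdicCompletionMap (L := L) (IsCMField.complexConj L) hw) t₀ + t₀ = 0) (ht₀v : Valued.v t₀ = 1)
    (hb₀ : b₀ + (galAdicCompletionMap (L := L) (IsCMField.complexConj L) hw) b₀ + 1 = 0) (hb₀v : Valued.v b₀ ≤ 1)
    (nT uT : ((cmDatum L 3 H').Local v)) (hnT : (((e nT).val : GL (Fin 3) (w.1.adicCompletion L)) : Matrix (Fin 3) (Fin 3) (w.1.adicCompletion L)) = !![1, 0, t₀; 0, 1, 0; 0, 0, 1])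
    (huT : (((e uT).val : GL (Fin 3) (w.1.adicCompletion L)) : Matrix (Fin 3) (Fin 3) (w.1.adicCompletion L)) = !![1, 1, b₀; 0, 1, -1; 0, 0, 1])
    {x : ((cmDatum L 3 H').Local v)} (hxK : x ∈ (cmLocalIntegralLevel L 3 H' v)) (hnil : (redMat (((x).val : GL (Fin 3) (UnitaryGroup.LocalRing L v)).val.map (Pi.evalRingHom (fun w' : PlacesOver L v => w'.1.adicCompletion L) w)) - 1) ^ 3 = 0)
    {y : ((cmDatum L 3 H').Local v)} (hy : (∀ a b, Valued.v (((toPlace v w (HeckeCharacter.uniformizer ↥(maximalRealSubfield L) v : v.adicCompletion ↥(maximalRealSubfield L))) ^ 2)⁻¹ * (((((localNonsplitEquiv (IsCMField.complexConj L) H' (IsCMField.complexConj_ne_one L) w hw (y * x * y⁻¹)) : ↥(unitaryGroupOfForm (galAdicCompletionMap (L := L) (IsCMField.complexConj L) hw) (placeForm H' w.1))) : GL (Fin 3) (w.1.adicCompletion L)) : Matrix (Fin 3) (Fin 3) (w.1.adicCompletion L)) a b - (1 : Matrix (Fin 3) (Fin 3) (w.1.adicCompletion L)) a b)) ≤ 1))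 :
    ((redMat (((x).val : GL (Fin 3) (UnitaryGroup.LocalRing L v)).val.map (Pi.evalRingHom (fun w' : PlacesOver L v => w'.1.adicCompletion L) w)) - 1).rank = 1 → g x = g nT) ∧ ((redMat (((x).val : GL (Fin 3) (UnitaryGroup.LocalRing L v)).val.map (Pi.evalRingHom (fun w' : PlacesOver L v => w'.1.adicCompletion L) w)) - 1).rank = 2 → g x = g uT) := by
  classical
  have hc1 : IsCMField.complexConj L ≠ 1 := IsCMField.complexConj_ne_one L
  -- §0 the place `w`: the `σ`-fixed uniformizer `ϖ_v`, the unramified datum at `ϖ_v`, `|2| = 1`, residual norms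
  have hϖv := Liu2021.LemD1IndexedNonVacuityInertCofinite.valued_toPlace_uniformizer_of_isUnramifiedIn L v hv w
  have hϖ : IsUniformizingElement (toPlace v w (HeckeCharacter.uniformizer ↥(maximalRealSubfield L) v : v.adicCompletion ↥(maximalRealSubfield L))) := isUniformizingElement_of_v_eq hϖv
  have hσϖ : (galAdicCompletionMap (L := L) (IsCMField.complexConj L) hw) (toPlace v w (HeckeCharacter.uniformizer ↥(maximalRealSubfield L) v : v.adicCompletion ↥(maximalRealSubfield L))) = (toPlace v w (HeckeCharacter.uniformizer ↥(maximalRealSubfield L) v : v.adicCompletion ↥(maximalRealSubfield L))) := galAdicCompletionMap_toPlace (IsCMField.complexConj L) w w hw _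
  have hϖ0 : (toPlace v w (HeckeCharacter.uniformizer ↥(maximalRealSubfield L) v : v.adicCompletion ↥(maximalRealSubfield L))) ≠ 0 := by
    intro h; rw [h, map_zero] at hϖv; exact WithZero.coe_ne_zero hϖv.symm
  have hϖ1 : Valued.v (toPlace v w (HeckeCharacter.uniformizer ↥(maximalRealSubfield L) v : v.adicCompletion ↥(maximalRealSubfield L))) < 1 := by
    rw [hϖv, ← WithZero.exp_zero]; exact WithZero.exp_lt_exp.2 (by norm_num)
  obtain ⟨ϖ₀, hd₀⟩ := unramifiedLocalConjDatum_adicCompletion (IsCMField.complexConj L) hc1 v w hw hv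
  have hd : UnramifiedLocalConjDatum (galAdicCompletionMap (L := L) (IsCMField.complexConj L) hw) (toPlace v w (HeckeCharacter.uniformizer ↥(maximalRealSubfield L) v : v.adicCompletion ↥(maximalRealSubfield L))) := ⟨hd₀.σσ, hd₀.vσ, hσϖ, hϖv, hd₀.trace, hd₀.norm⟩
  have h2v : Valued.v (2 : (w.1.adicCompletion L)) = 1 := (isUnit_two_integer_iff_valued_eq_one L w.1).1 h2
  have hN : ∀ u : (w.1.adicCompletion L), (galAdicCompletionMap (L := L) (IsCMField.complexConj L) hw) u = u → Valued.v u = 1 → ∃ z : (w.1.adicCompletion L), Valued.v (z * (galAdicCompletionMap (L := L) (IsCMField.complexConj L) hw) z - u) < 1 :=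
    fun u hσu hu => exists_v_mul_map_sub_lt_one_of_inert L w hw hv u hσu hu
  -- §1 the frame: `placeForm Φ₃ w = J₀`, memberships, integrality of `T`
  have hJw : placeForm (Matrix.of fun i j : Fin 3 => if i.val + j.val + 1 = 3 then (1 : L) else 0) w.1 = ((StdForm.antidiagonal 3).over (w.1.adicCompletion L)) := by
    rw [placeForm, antidiagOne_eq_over, StdForm.over_map]
  have hU : ∀ z, ((e z).val : GL (Fin 3) (w.1.adicCompletion L)) ∈ (unitaryGroupOfForm (galAdicCompletionMap (L := L) (IsCMField.complexConj L) hw) ((StdForm.antidiagonal 3).over (w.1.adicCompletion L))) := fun z => by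
    rw [← hJw]; exact (e z).2
  have hTi : IsIntMatrix (T : Matrix (Fin 3) (Fin 3) (w.1.adicCompletion L)) := ((mem_glInt_iff_isIntMatrix L 3 w T).1 hT).1
  have hTi' : IsIntMatrix ((T⁻¹ : GL (Fin 3) (w.1.adicCompletion L)) : Matrix (Fin 3) (Fin 3) (w.1.adicCompletion L)) := ((mem_glInt_iff_isIntMatrix L 3 w T).1 hT).2
  have hTT' : (T : Matrix (Fin 3) (Fin 3) (w.1.adicCompletion L)) * ((T⁻¹ : GL (Fin 3) (w.1.adicCompletion L)) : Matrix (Fin 3) (Fin 3) (w.1.adicCompletion L)) = 1 := by rw [← Units.val_mul, mul_inv_cancel, Units.val_one]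
  have hT'T : ((T⁻¹ : GL (Fin 3) (w.1.adicCompletion L)) : Matrix (Fin 3) (Fin 3) (w.1.adicCompletion L)) * (T : Matrix (Fin 3) (Fin 3) (w.1.adicCompletion L)) = 1 := by rw [← Units.val_mul, inv_mul_cancel, Units.val_one]
  -- §2 opaque names for the images of `x`, `y`, `γ = y x y⁻¹` in the two models
  obtain ⟨X₀, hX₀⟩ : ∃ X : GL (Fin 3) (w.1.adicCompletion L), X = (((localNonsplitEquiv (IsCMField.complexConj L) H' (IsCMField.complexConj_ne_one L) w hw x)).val : GL (Fin 3) (w.1.adicCompletion L)) := ⟨_, rfl⟩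
  obtain ⟨Γ₀, hΓ₀⟩ : ∃ X : GL (Fin 3) (w.1.adicCompletion L), X = (((localNonsplitEquiv (IsCMField.complexConj L) H' (IsCMField.complexConj_ne_one L) w hw (y * x * y⁻¹))).val : GL (Fin 3) (w.1.adicCompletion L)) := ⟨_, rfl⟩
  obtain ⟨XR, hXR⟩ : ∃ X : GL (Fin 3) (w.1.adicCompletion L), X = ((e x).val : GL (Fin 3) (w.1.adicCompletion L)) := ⟨_, rfl⟩
  obtain ⟨GR, hGR⟩ : ∃ X : GL (Fin 3) (w.1.adicCompletion L), X = ((e y).val : GL (Fin 3) (w.1.adicCompletion L)) := ⟨_, rfl⟩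
  obtain ⟨ΓR, hΓR⟩ : ∃ X : GL (Fin 3) (w.1.adicCompletion L), X = ((e (y * x * y⁻¹)).val : GL (Fin 3) (w.1.adicCompletion L)) := ⟨_, rfl⟩
  have hXRT : XR = T * X₀ * T⁻¹ := by rw [hXR, hX₀]; exact he x
  have hΓRT : ΓR = T * Γ₀ * T⁻¹ := by rw [hΓR, hΓ₀]; exact he _
  have he1 : e (y * x * y⁻¹) = e (y * x) * e y⁻¹ := map_mul e _ _
  have he2 : e (y * x) = e y * e x := map_mul e _ _
  have he3 : e y⁻¹ = (e y)⁻¹ := map_inv e _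
  have hΓprod : ΓR = GR * XR * GR⁻¹ := by
    rw [hΓR, hGR, hXR, he1, he2, he3]; rfl
  have hΓU : ΓR ∈ (unitaryGroupOfForm (galAdicCompletionMap (L := L) (IsCMField.complexConj L) hw) ((StdForm.antidiagonal 3).over (w.1.adicCompletion L))) := by rw [hΓR]; exact hU _
  have hGU : GR ∈ (unitaryGroupOfForm (galAdicCompletionMap (L := L) (IsCMField.complexConj L) hw) ((StdForm.antidiagonal 3).over (w.1.adicCompletion L))) := by rw [hGR]; exact hU _
  have hxg : XR = GR⁻¹ * ΓR * GR := by rw [hΓprod]; group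
  -- §3 integrality of `e x`, the 2-deep congruence of `e γ`
  have hxint : IsIntMatrix (XR : Matrix (Fin 3) (Fin 3) (w.1.adicCompletion L)) := by
    rw [hXR]; exact ((mem_glInt_iff_isIntMatrix L 3 w _).1 ((hKe x).1 hxK)).1
  have hX₀int : X₀ ∈ glInt 3 (w.1.adicCompletion L) := by
    rw [hX₀]; exact (mem_localIntegralLevel_iff_of_smul_eq (IsCMField.complexConj L) 3 H' hc1 w hw x).1 hxK
  have hΓ₀2' : IsIntMatrix (((toPlace v w (HeckeCharacter.uniformizer ↥(maximalRealSubfield L) v : v.adicCompletion ↥(maximalRealSubfield L))) ^ 2)⁻¹ • (((((localNonsplitEquiv (IsCMField.complexConj L) H' (IsCMField.complexConj_ne_one L) w hw (y * x * y⁻¹))).val : GL (Fin 3) (w.1.adicCompletion L)) : Matrix (Fin 3) (Fin 3) (w.1.adicCompletion L)) - 1)) := by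
    intro a b
    simpa only [Matrix.smul_apply, Matrix.sub_apply, smul_eq_mul] using hy a b
  have hΓ₀2 : IsIntMatrix (((toPlace v w (HeckeCharacter.uniformizer ↥(maximalRealSubfield L) v : v.adicCompletion ↥(maximalRealSubfield L))) ^ 2)⁻¹ • ((Γ₀ : Matrix (Fin 3) (Fin 3) (w.1.adicCompletion L)) - 1)) := by rw [hΓ₀]; exact hΓ₀2'
  have hΓR2 : IsIntMatrix (((toPlace v w (HeckeCharacter.uniformizer ↥(maximalRealSubfield L) v : v.adicCompletion ↥(maximalRealSubfield L))) ^ 2)⁻¹ • ((ΓR : Matrix (Fin 3) (Fin 3) (w.1.adicCompletion L)) - 1)) := by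
    have h := isIntMatrix_smul_conj_sub_one (((toPlace v w (HeckeCharacter.uniformizer ↥(maximalRealSubfield L) v : v.adicCompletion ↥(maximalRealSubfield L))) ^ 2)⁻¹) hTi hTi' hTT' hΓ₀2
    have hm : (ΓR : Matrix (Fin 3) (Fin 3) (w.1.adicCompletion L)) = (T : Matrix (Fin 3) (Fin 3) (w.1.adicCompletion L)) * (Γ₀ : Matrix (Fin 3) (Fin 3) (w.1.adicCompletion L)) * ((T⁻¹ : GL (Fin 3) (w.1.adicCompletion L)) : Matrix (Fin 3) (Fin 3) (w.1.adicCompletion L)) := by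
      rw [hΓRT]; simp only [Units.val_mul]
    rw [hm]; exact h
  -- §4 the residual nilpotent `N = red(x_w) − 1` and the dictionary «Jordan rank ↔ congruences»
  have hMx : ((X₀ : GL (Fin 3) (w.1.adicCompletion L)) : Matrix (Fin 3) (Fin 3) (w.1.adicCompletion L)) = (((x).val : GL (Fin 3) (UnitaryGroup.LocalRing L v)).val.map (Pi.evalRingHom (fun w' : PlacesOver L v => w'.1.adicCompletion L) w)) := by
    rw [hX₀]; exact coe_localNonsplitEquiv_apply L H' v w hw x
  obtain ⟨Nx, hNx⟩ : ∃ N : Matrix (Fin 3) (Fin 3) 𝓀[(w.1.adicCompletion L)], N = redMat ((X₀ : GL (Fin 3) (w.1.adicCompletion L)) : Matrix (Fin 3) (Fin 3) (w.1.adicCompletion L)) - 1 := ⟨_, rfl⟩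
  have hnilN : Nx ^ 3 = 0 := by rw [hNx, hMx]; exact hnil
  have hnilN' : IsNilpotent Nx := ⟨3, hnilN⟩
  have hX₀v : ValBound 1 ((X₀ : GL (Fin 3) (w.1.adicCompletion L)) : Matrix (Fin 3) (Fin 3) (w.1.adicCompletion L)) := valBound_one_of_mem_glInt hX₀int
  have hsubv : ValBound 1 (((X₀ : GL (Fin 3) (w.1.adicCompletion L)) : Matrix (Fin 3) (Fin 3) (w.1.adicCompletion L)) - 1) := by
    have h := hX₀v.sub valBound_one
    exact h
  have hredsub : redMat (((X₀ : GL (Fin 3) (w.1.adicCompletion L)) : Matrix (Fin 3) (Fin 3) (w.1.adicCompletion L)) - 1) = Nx := by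
    rw [hNx, redMat_sub hX₀v valBound_one, redMat_one]
  have hsqv : ValBound 1 ((((X₀ : GL (Fin 3) (w.1.adicCompletion L)) : Matrix (Fin 3) (Fin 3) (w.1.adicCompletion L)) - 1) ^ 2) := by
    have h := hsubv.mul hsubv
    rw [one_mul, ← sq] at h
    exact h
  have hredsq : redMat ((((X₀ : GL (Fin 3) (w.1.adicCompletion L)) : Matrix (Fin 3) (Fin 3) (w.1.adicCompletion L)) - 1) ^ 2) = Nx * Nx := by
    rw [sq, redMat_mul hsubv hsubv, hredsub]
  -- (a) `x_w ≡ 1 (ϖ)` forces `N = 0`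
  have hN0_of : IsIntMatrix ((toPlace v w (HeckeCharacter.uniformizer ↥(maximalRealSubfield L) v : v.adicCompletion ↥(maximalRealSubfield L)))⁻¹ • (((X₀ : GL (Fin 3) (w.1.adicCompletion L)) : Matrix (Fin 3) (Fin 3) (w.1.adicCompletion L)) - 1)) → Nx = 0 := fun hI => by
    have hle : ∀ i j, valuation (w.1.adicCompletion L) ((((X₀ : GL (Fin 3) (w.1.adicCompletion L)) : Matrix (Fin 3) (Fin 3) (w.1.adicCompletion L)) - 1) i j) ≤ valuation (w.1.adicCompletion L) (toPlace v w (HeckeCharacter.uniformizer ↥(maximalRealSubfield L) v : v.adicCompletion ↥(maximalRealSubfield L))) := fun i j =>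
      (v_le_iff_valuation_le _ _).1 ((UnitaryGroup.isIntMatrix_inv_smul_iff hϖ0 _).1 hI i j)
    have h0 : (redMat ((X₀ : GL (Fin 3) (w.1.adicCompletion L)) : Matrix (Fin 3) (Fin 3) (w.1.adicCompletion L)) - 1).rank = 0 := (rank_redMat_sub_one_eq_zero_iff_forall_valuation_le hϖ hX₀int).2 hle
    rw [← hNx] at h0
    exact (Literature.GroupTheory.SpecificGroups.rank_eq_zero_iff_eq_zero Nx).1 h0
  -- (b) `N² = 0` gives `(x_w − 1)² ≡ 0 (ϖ)`
  have hsq_of : Nx * Nx = 0 → IsIntMatrix ((toPlace v w (HeckeCharacter.uniformizer ↥(maximalRealSubfield L) v : v.adicCompletion ↥(maximalRealSubfield L)))⁻¹ • (((X₀ : GL (Fin 3) (w.1.adicCompletion L)) : Matrix (Fin 3) (Fin 3) (w.1.adicCompletion L)) - 1) ^ 2) := fun hsq => by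
    have hred0 : redMat ((((X₀ : GL (Fin 3) (w.1.adicCompletion L)) : Matrix (Fin 3) (Fin 3) (w.1.adicCompletion L)) - 1) ^ 2) = 0 := by rw [hredsq, hsq]
    have hlt := (redMat_eq_zero_iff_forall_valuation_lt_one hsqv).1 hred0
    refine (UnitaryGroup.isIntMatrix_inv_smul_iff hϖ0 _).2 fun i j => ?_
    rw [hϖv]
    exact (v_lt_one_iff _).1 ((v_lt_one_iff_valuation_lt_one _).2 (hlt i j))
  -- (c) `(x_w − 1)² ≡ 0 (ϖ)` gives `N² = 0`
  have hsq_of' : IsIntMatrix ((toPlace v w (HeckeCharacter.uniformizer ↥(maximalRealSubfield L) v : v.adicCompletion ↥(maximalRealSubfield L)))⁻¹ • (((X₀ : GL (Fin 3) (w.1.adicCompletion L)) : Matrix (Fin 3) (Fin 3) (w.1.adicCompletion L)) - 1) ^ 2) → Nx * Nx = 0 := fun hI => by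
    have hlt : ∀ i j, valuation (w.1.adicCompletion L) ((((((X₀ : GL (Fin 3) (w.1.adicCompletion L)) : Matrix (Fin 3) (Fin 3) (w.1.adicCompletion L)) - 1) ^ 2 : Matrix (Fin 3) (Fin 3) (w.1.adicCompletion L))) i j) < 1 := fun i j =>
      (v_lt_one_iff_valuation_lt_one _).1 (lt_of_le_of_lt ((UnitaryGroup.isIntMatrix_inv_smul_iff hϖ0 (((((X₀ : GL (Fin 3) (w.1.adicCompletion L)) : Matrix (Fin 3) (Fin 3) (w.1.adicCompletion L)) - 1) ^ 2 : Matrix (Fin 3) (Fin 3) (w.1.adicCompletion L)))).1 hI i j) hϖ1)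
    have h0 := (redMat_eq_zero_iff_forall_valuation_lt_one hsqv).2 hlt
    rwa [hredsq] at h0
  -- transports between `x_w` and `e x = T x_w T⁻¹`
  have hXm : (XR : Matrix (Fin 3) (Fin 3) (w.1.adicCompletion L)) = (T : Matrix (Fin 3) (Fin 3) (w.1.adicCompletion L)) * ((X₀ : GL (Fin 3) (w.1.adicCompletion L)) : Matrix (Fin 3) (Fin 3) (w.1.adicCompletion L)) * ((T⁻¹ : GL (Fin 3) (w.1.adicCompletion L)) : Matrix (Fin 3) (Fin 3) (w.1.adicCompletion L)) := by
    rw [hXRT]; simp only [Units.val_mul]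
  have hX₀m : ((X₀ : GL (Fin 3) (w.1.adicCompletion L)) : Matrix (Fin 3) (Fin 3) (w.1.adicCompletion L)) = ((T⁻¹ : GL (Fin 3) (w.1.adicCompletion L)) : Matrix (Fin 3) (Fin 3) (w.1.adicCompletion L)) * (XR : Matrix (Fin 3) (Fin 3) (w.1.adicCompletion L)) * (T : Matrix (Fin 3) (Fin 3) (w.1.adicCompletion L)) := by
    have h : X₀ = T⁻¹ * XR * T := by rw [hXRT]; group
    rw [h]; simp only [Units.val_mul]
  -- §6 the two ranks
  refine ⟨fun hr1 => ?_, fun hr2 => ?_⟩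
  · have hr1' : Nx.rank = 1 := by rw [hNx, hMx]; exact hr1
    obtain ⟨hNne, hsq⟩ := (rank_eq_one_iff_of_isNilpotent hnilN').1.1 hr1'
    have hx1 : ¬ IsIntMatrix ((toPlace v w (HeckeCharacter.uniformizer ↥(maximalRealSubfield L) v : v.adicCompletion ↥(maximalRealSubfield L)))⁻¹ • ((XR : Matrix (Fin 3) (Fin 3) (w.1.adicCompletion L)) - 1)) := fun hI => hNne (hN0_of (by
      rw [hX₀m]; exact isIntMatrix_smul_conj_sub_one ((toPlace v w (HeckeCharacter.uniformizer ↥(maximalRealSubfield L) v : v.adicCompletion ↥(maximalRealSubfield L)))⁻¹) hTi' hTi hT'T hI))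
    have hx2 : IsIntMatrix ((toPlace v w (HeckeCharacter.uniformizer ↥(maximalRealSubfield L) v : v.adicCompletion ↥(maximalRealSubfield L)))⁻¹ • ((XR : Matrix (Fin 3) (Fin 3) (w.1.adicCompletion L)) - 1) ^ 2) := by
      rw [hXm]; exact isIntMatrix_smul_conj_sub_one_sq ((toPlace v w (HeckeCharacter.uniformizer ↥(maximalRealSubfield L) v : v.adicCompletion ↥(maximalRealSubfield L)))⁻¹) hTi hTi' hTT' hT'T (hsq_of hsq)
    obtain ⟨k, n, u, hkU, hki, hki', hn, -, -, -, huU, hu2, hkxk⟩ :=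
      exists_conj_eq_levelTwo_mul_cornerUnipotent_of_two_deep hd h2v hN hΓU hΓR2 hGU hxg hxint hx1 hx2 ht₀ ht₀v
    exact apply_eq_of_conj_eq_levelTwo_mul L H' w hw g hginv hg2 T hT e he hKe hkU hki hki' huU hu2
      (by rw [← hXR, ← (Units.ext (by rw [hn, hnT]) : n = ((e nT).val : GL (Fin 3) (w.1.adicCompletion L)))]; exact hkxk)
  · have hr2' : Nx.rank = 2 := by rw [hNx, hMx]; exact hr2
    have hsq : Nx * Nx ≠ 0 := (rank_eq_one_iff_of_isNilpotent hnilN').2.1 hr2'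
    have hxreg : ¬ IsIntMatrix ((toPlace v w (HeckeCharacter.uniformizer ↥(maximalRealSubfield L) v : v.adicCompletion ↥(maximalRealSubfield L)))⁻¹ • ((XR : Matrix (Fin 3) (Fin 3) (w.1.adicCompletion L)) - 1) ^ 2) := fun hI => hsq (hsq_of' (by
      rw [hX₀m]; exact isIntMatrix_smul_conj_sub_one_sq ((toPlace v w (HeckeCharacter.uniformizer ↥(maximalRealSubfield L) v : v.adicCompletion ↥(maximalRealSubfield L)))⁻¹) hTi' hTi hT'T hTT' hI))
    obtain ⟨k, m, u, hkU, hki, hki', hm, -, -, -, huU, hu2, hkxk⟩ :=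
      exists_conj_eq_levelTwo_mul_upperUnipotent_one_of_two_deep hd h2v hΓU hΓR2 hGU hxg hxint hxreg hb₀ hb₀v
    exact apply_eq_of_conj_eq_levelTwo_mul L H' w hw g hginv hg2 T hT e he hKe hkU hki hki' huU hu2
      (by rw [← hXR, ← (Units.ext (by rw [hm, huT]) : m = ((e uT).val : GL (Fin 3) (w.1.adicCompletion L)))]; exact hkxk)

set_option maxHeartbeats 800000 in
-- budget only: one statement-heavy declaration (the END's organ-V tokens); no search tactic runs long here.
/-- **ORGAN V, BOUNDARY HALF — the two boundary values of a level-2 `K`-class piece** (END fold v3.2 `stub_liftValues`, BD-conjuncts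
VERBATIM): there is `c : ℕ → ℂ` with `c 0 = 0` such that `g x = c 1` (resp. `c 2`) for every `x ∈ K` with `(red x_w − 1)³ = 0`,
`rank(red x_w − 1) = 1` (resp. `2`) that is `G′_v`-conjugate into `K(2)`.  Proof: fix ONE good-reduction frame (★ `exists_frame_of_nonsplit`),
one skew unit `t₀` (★ `exists_v_mul_map_sub_lt_one_of_inert`'s companion ★ `exists_v_eq_one_and_map_eq_neg`) and `b₀ = −t` from the trace
datum; put `c 1 := g (e⁻¹ n(t₀))`, `c 2 := g (e⁻¹ u(1,b₀))` and apply `apply_eq_of_two_deep_of_rank_redMat_sub_one`.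
[cite: Rogawski1990, §3.9 p. 32, Prop. 3.9.1; §4.9 p. 54] [cite: Tits1979, §3.5] [cite: Kottwitz1986, §3] -/
theorem exists_boundaryValues_of_levelTwo
    (L : Type) [Field L] [NumberField L] [IsCMField L] (H' : Matrix (Fin 3) (Fin 3) L)
    {v : HeightOneSpectrum (𝓞 ↥(maximalRealSubfield L))}
    (hH' : (H'.map (cmConjRingHom L)).transpose = H') (w : PlacesOver L v)
    (hw : IsCMField.complexConj L • w.1 = w.1) (hv : Algebra.IsUnramifiedIn (𝓞 L) v.asIdeal)
    (hH'w : IsUnit (placeForm H' w.1)) (hH'i : hH'w.unit ∈ glInt 3 (w.1.adicCompletion L))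
    (h2 : IsUnit (2 : 𝒪[(w.1.adicCompletion L)]))
    (g : ((cmDatum L 3 H').Local v) → ℂ)
    (hginv : ∀ u ∈ cmLocalIntegralLevel L 3 H' v, ∀ x, g (u * x * u⁻¹) = g x)
    (hg2 : ∀ u : ((cmDatum L 3 H').Local v),
      (∀ a b, Valued.v (((toPlace v w (HeckeCharacter.uniformizer ↥(maximalRealSubfield L) v : v.adicCompletion ↥(maximalRealSubfield L))) ^ 2)⁻¹ * (((((localNonsplitEquiv (IsCMField.complexConj L) H' (IsCMField.complexConj_ne_one L) w hw u) : ↥(unitaryGroupOfForm (galAdicCompletionMap (L := L) (IsCMField.complexConj L) hw) (placeForm H' w.1))) : GL (Fin 3) (w.1.adicCompletion L)) : Matrix (Fin 3) (Fin 3) (w.1.adicCompletion L)) a b - (1 : Matrix (Fin 3) (Fin 3) (w.1.adicCompletion L)) a b)) ≤ 1) →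
      ∀ x, g (u * x) = g x) :
    ∃ c : ℕ → ℂ, c 0 = 0 ∧
      (∀ x : ((cmDatum L 3 H').Local v), (x ∈ cmLocalIntegralLevel L 3 H' v ∧ (redMat (((x).val : GL (Fin 3) (UnitaryGroup.LocalRing L v)).val.map (Pi.evalRingHom (fun w' : PlacesOver L v => w'.1.adicCompletion L) w)) - 1) ^ 3 = 0 ∧ (redMat (((x).val : GL (Fin 3) (UnitaryGroup.LocalRing L v)).val.map (Pi.evalRingHom (fun w' : PlacesOver L v => w'.1.adicCompletion L) w)) - 1).rank = 1 ∧
        ∃ y : ((cmDatum L 3 H').Local v), (∀ a b, Valued.v (((toPlace v w (HeckeCharacter.uniformizer ↥(maximalRealSubfield L) v : v.adicCompletion ↥(maximalRealSubfield L))) ^ 2)⁻¹ * (((((localNonsplitEquiv (IsCMField.complexConj L) H' (IsCMField.complexConj_ne_one L) w hw (y * x * y⁻¹)) : ↥(unitaryGroupOfForm (galAdicCompletionMap (L := L) (IsCMField.complexConj L) hw) (placeForm H' w.1))) : GL (Fin 3) (w.1.adicCompletion L)) : Matrix (Fin 3) (Fin 3) (w.1.adicCompletion L)) a b - (1 : Matrix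 (Fin 3) (Fin 3) (w.1.adicCompletion L)) a b)) ≤ 1)) → g x = c 1) ∧
      (∀ x : ((cmDatum L 3 H').Local v), (x ∈ cmLocalIntegralLevel L 3 H' v ∧ (redMat (((x).val : GL (Fin 3) (UnitaryGroup.LocalRing L v)).val.map (Pi.evalRingHom (fun w' : PlacesOver L v => w'.1.adicCompletion L) w)) - 1) ^ 3 = 0 ∧ (redMat (((x).val : GL (Fin 3) (UnitaryGroup.LocalRing L v)).val.map (Pi.evalRingHom (fun w' : PlacesOver L v => w'.1.adicCompletion L) w)) - 1).rank = 2 ∧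
        ∃ y : ((cmDatum L 3 H').Local v), (∀ a b, Valued.v (((toPlace v w (HeckeCharacter.uniformizer ↥(maximalRealSubfield L) v : v.adicCompletion ↥(maximalRealSubfield L))) ^ 2)⁻¹ * (((((localNonsplitEquiv (IsCMField.complexConj L) H' (IsCMField.complexConj_ne_one L) w hw (y * x * y⁻¹)) : ↥(unitaryGroupOfForm (galAdicCompletionMap (L := L) (IsCMField.complexConj L) hw) (placeForm H' w.1))) : GL (Fin 3) (w.1.adicCompletion L)) : Matrix (Fin 3) (Fin 3) (w.1.adicCompletion L)) a b - (1 : Matrix (Fin 3) (Fin 3) (w.1.adicCompletion L)) a b)) ≤ 1)) → g x = c 2) := by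
  classical
  have hc1 : IsCMField.complexConj L ≠ 1 := IsCMField.complexConj_ne_one L
  -- the frame
  have hH'' : (H'.map (IsCMField.complexConj L))ᵀ = H' := by
    refine Eq.trans ?_ hH'
    rfl
  obtain ⟨T, e, hT, he, hKe, -⟩ := exists_frame_of_nonsplit L H' hH'' w hw hv hH'w hH'i
  have hJw : placeForm (Matrix.of fun i j : Fin 3 => if i.val + j.val + 1 = 3 then (1 : L) else 0) w.1 = ((StdForm.antidiagonal 3).over (w.1.adicCompletion L)) := by
    rw [placeForm, antidiagOne_eq_over, StdForm.over_map]
  -- the datum, a skew unit `t₀`, and `b₀ := -t`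
  have hϖv := Liu2021.LemD1IndexedNonVacuityInertCofinite.valued_toPlace_uniformizer_of_isUnramifiedIn L v hv w
  have hσϖ : (galAdicCompletionMap (L := L) (IsCMField.complexConj L) hw) (toPlace v w (HeckeCharacter.uniformizer ↥(maximalRealSubfield L) v : v.adicCompletion ↥(maximalRealSubfield L))) = (toPlace v w (HeckeCharacter.uniformizer ↥(maximalRealSubfield L) v : v.adicCompletion ↥(maximalRealSubfield L))) := galAdicCompletionMap_toPlace (IsCMField.complexConj L) w w hw _
  obtain ⟨ϖ₀, hd₀⟩ := unramifiedLocalConjDatum_adicCompletion (IsCMField.complexConj L) hc1 v w hw hv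
  have hd : UnramifiedLocalConjDatum (galAdicCompletionMap (L := L) (IsCMField.complexConj L) hw) (toPlace v w (HeckeCharacter.uniformizer ↥(maximalRealSubfield L) v : v.adicCompletion ↥(maximalRealSubfield L))) := ⟨hd₀.σσ, hd₀.vσ, hσϖ, hϖv, hd₀.trace, hd₀.norm⟩
  have hσne : ∃ x : (w.1.adicCompletion L), (galAdicCompletionMap (L := L) (IsCMField.complexConj L) hw) x ≠ x := UnitaryGroup.exists_galAdicCompletionMap_ne (IsCMField.complexConj L) hc1 v w hw
  obtain ⟨t₀, ht₀v, ht₀σ⟩ := hd.exists_v_eq_one_and_map_eq_neg hσne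
  have ht₀ : (galAdicCompletionMap (L := L) (IsCMField.complexConj L) hw) t₀ + t₀ = 0 := by rw [ht₀σ, neg_add_cancel]
  obtain ⟨t, htv, ht⟩ := hd.trace
  have hb₀ : (-t) + (galAdicCompletionMap (L := L) (IsCMField.complexConj L) hw) (-t) + 1 = 0 := by rw [map_neg, ← ht]; ring
  have hb₀v : Valued.v (-t) ≤ 1 := by rw [Valuation.map_neg]; exact htv
  -- the two normal forms, pulled back along `e`
  obtain ⟨n, hn, -⟩ := exists_units_coe_eq_cornerUnipotent (K := (w.1.adicCompletion L)) t₀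
  have hnU : n ∈ (unitaryGroupOfForm (galAdicCompletionMap (L := L) (IsCMField.complexConj L) hw) ((StdForm.antidiagonal 3).over (w.1.adicCompletion L))) := (mem_unitaryGroupOfForm_iff_of_coe_eq_cornerUnipotent (galAdicCompletionMap (L := L) (IsCMField.complexConj L) hw) hn).2 ht₀
  obtain ⟨m, hm, -⟩ := exists_units_coe_eq_upperTriangularUnipotent (1 : (w.1.adicCompletion L)) (-t) (-1)
  have hmU : m ∈ (unitaryGroupOfForm (galAdicCompletionMap (L := L) (IsCMField.complexConj L) hw) ((StdForm.antidiagonal 3).over (w.1.adicCompletion L))) := by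
    refine (mem_unitaryGroupOfForm_iff_of_coe_eq_upperUnipotent (galAdicCompletionMap (L := L) (IsCMField.complexConj L) hw) hd.σσ hm).2 ⟨by rw [map_one], ?_⟩
    rw [map_one, mul_one]; exact hb₀
  have hnU' : n ∈ (unitaryGroupOfForm (galAdicCompletionMap (L := L) (IsCMField.complexConj L) hw) (placeForm (Matrix.of fun i j : Fin 3 => if i.val + j.val + 1 = 3 then (1 : L) else 0) w.1)) := by rw [hJw]; exact hnU
  have hmU' : m ∈ (unitaryGroupOfForm (galAdicCompletionMap (L := L) (IsCMField.complexConj L) hw) (placeForm (Matrix.of fun i j : Fin 3 => if i.val + j.val + 1 = 3 then (1 : L) else 0) w.1)) := by rw [hJw]; exact hmU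
  obtain ⟨nT, hnT⟩ : ∃ z : ((cmDatum L 3 H').Local v), z = e.symm ⟨n, hnU'⟩ := ⟨_, rfl⟩
  obtain ⟨uT, huT⟩ : ∃ z : ((cmDatum L 3 H').Local v), z = e.symm ⟨m, hmU'⟩ := ⟨_, rfl⟩
  have henT : (((e nT).val : GL (Fin 3) (w.1.adicCompletion L)) : Matrix (Fin 3) (Fin 3) (w.1.adicCompletion L)) = !![1, 0, t₀; 0, 1, 0; 0, 0, 1] := by
    rw [hnT, e.apply_symm_apply]; exact hn
  have heuT : (((e uT).val : GL (Fin 3) (w.1.adicCompletion L)) : Matrix (Fin 3) (Fin 3) (w.1.adicCompletion L)) = !![1, 1, -t; 0, 1, -1; 0, 0, 1] := by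
    rw [huT, e.apply_symm_apply]; exact hm
  refine ⟨fun s => if s = 1 then g nT else if s = 2 then g uT else 0, by simp, ?_, ?_⟩
  · rintro x ⟨hxK, hnil, hr, y, hy⟩
    have h := (apply_eq_of_two_deep_of_rank_redMat_sub_one L H' w hw hv h2 g hginv hg2 T hT e he hKe ht₀ ht₀v hb₀ hb₀v
      nT uT henT heuT hxK hnil hy).1 hr
    simpa using h
  · rintro x ⟨hxK, hnil, hr, y, hy⟩
    have h := (apply_eq_of_two_deep_of_rank_redMat_sub_one L H' w hw hv h2 g hginv hg2 T hT e he hKe ht₀ ht₀v hb₀ hb₀v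
      nT uT henT heuT hxK hnil hy).2 hr
    simpa using h

end OrganVBoundary

end Literature.NumberTheory.Rogawski1990
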